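import Literature.Analysis.ValidatedNumerics.Certificate
import HarnessLib

/-!
# Window / box-cover certificates: kd-trees of boxes with per-leaf checks

Topic `Literature/Analysis/ValidatedNumerics`. The generic form of the tree's "window" computations
(`Summits/RiemannHypothesis/.../UniversalFactorMedium*Window*.lean`: a claim for every parameter
`a` of an interval is proved by covering the interval with finitely many boxes and running an
interval-arithmetic check per box): a CLAIM `∀ x ∈ B, P x` about all real points of a rational
box `B`, a CERTIFICATE that is a kd-tree (each node splits one coordinate of the current box at a
rational cut; each leaf carries the data of a per-box check), a CHECKER that walks the tree
(structural recursion, kernel-evaluable) and runs a user-supplied Boolean leaf check on each leaf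
box, and the SOUNDNESS theorem: if every accepted leaf check proves `P` on its box then an accepted
tree proves `P` on the root box. The compute lane emits the tree (adaptive bisection until the
leaf check passes) as JSON; printed as a Lean term it is `KdCert.split 0 (1/2) (.leaf c₁) (.leaf c₂)`.

## Contents

* `Box = List (ℚ × ℚ)` (coordinate `i` ranges over `[lo_i, hi_i]`, `[0, 0]` beyond the list — the
  convention of `BoundClaim.boxAt`), `Box.mem`, `Box.split`, `Box.mem_split` (the two halves cover);
* `KdCert α` (`leaf a | split axis cut lo hi`), `KdCert.check leafOK B t`, **`KdCert.sound`**;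
  `KdCert.ofCuts` (the 1-D window format: consecutive breakpoints with one leaf datum per cell);
* the worked leaf check `exprLeOn e b B prec` (natural interval extension of an `ArithExpr` on the
  box, `ArithExpr.enclose`, compared with `b`), `exprLeOn_sound`, the claim format `BoxBoundClaim`
  and the verifier `kdBoundVerifier : Verifier BoxBoundClaim BoxBoundClaim.Holds` whose
  certificates are kd-trees of working precisions — interval evaluation WITH SUBDIVISION, which is
  what makes range enclosures converge (`boundVerifier` of `Certificate.lean` is the one-box case);
* a closing kernel `example`: `x(1 − x) ≤ 3/8` on `[0, 1]` needs (and gets) two bisections.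

## References

* R. E. Moore, *Interval Analysis*, Prentice-Hall (1966), Ch. 3 (inclusion property) and §4.4
  (refinement by subdivision: the excess width of the natural interval extension is `O(w(X))`, so
  uniform subdivision converges). [cite: Moore1966, Ch. 3–4]
* `girving/interval`, `alerad/LeanCert` — design references for expression/certificate layers.
-/

namespace Literature.Analysis.ValidatedNumerics

open NonemptyInterval

/-! ### Boxes -/

/-- A rational box: coordinate `i` ranges over `[(B i).1, (B i).2]`; coordinates beyond the end of
the list range over the junk interval `[0, 0]` (cf. `BoundClaim.boxAt`). [folklore] -/
abbrev Box : Type := List (ℚ × ℚ)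

namespace Box

/-- The interval of coordinate `i` (`(0, 0)` beyond the end). [folklore] -/
def ivl (B : Box) (i : ℕ) : ℚ × ℚ := B.getD i (0, 0)

/-- A real point lies in the box: every coordinate lies in its interval. [folklore] -/
def mem (B : Box) (x : ℕ → ℝ) : Prop := ∀ i, ((B.ivl i).1 : ℝ) ≤ x i ∧ x i ≤ ((B.ivl i).2 : ℝ)

/-- Bisection of coordinate `axis` at the cut `c`: the lower part `[lo, c]` and the upper part
`[c, hi]` (if `axis` is beyond the end of the list both parts are the box itself). [folklore] -/
def split (B : Box) (axis : ℕ) (c : ℚ) : Box × Box :=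
  (B.set axis ((B.ivl axis).1, c), B.set axis (c, (B.ivl axis).2))

/-- Coordinates other than the split one are unchanged. [folklore] -/
theorem ivl_set_ne (B : Box) {axis i : ℕ} (h : axis ≠ i) (I : ℚ × ℚ) : ivl (B.set axis I) i = B.ivl i := by
  unfold ivl
  rw [List.getD_eq_getElem?_getD, List.getD_eq_getElem?_getD, List.getElem?_set_ne h]

/-- The split coordinate, when it is stored, becomes the new interval. [folklore] -/
theorem ivl_set_self (B : Box) {axis : ℕ} (h : axis < B.length) (I : ℚ × ℚ) :
    ivl (B.set axis I) axis = I := by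
  unfold ivl
  rw [List.getD_eq_getElem?_getD, List.getElem?_set_self h]
  rfl

/-- **The two halves of a split cover the box.** [folklore] -/
theorem mem_split {B : Box} {x : ℕ → ℝ} (hx : B.mem x) (axis : ℕ) (c : ℚ) :
    (B.split axis c).1.mem x ∨ (B.split axis c).2.mem x := by
  by_cases hlen : axis < B.length
  · rcases le_total (x axis) (c : ℝ) with hc | hc
    · refine Or.inl fun i ↦ ?_
      by_cases hi : axis = i
      · subst hi
        simp only [split, ivl_set_self B hlen]
        exact ⟨(hx axis).1, hc⟩
      · simp only [split, ivl_set_ne B hi]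
        exact hx i
    · refine Or.inr fun i ↦ ?_
      by_cases hi : axis = i
      · subst hi
        simp only [split, ivl_set_self B hlen]
        exact ⟨hc, (hx axis).2⟩
      · simp only [split, ivl_set_ne B hi]
        exact hx i
  · refine Or.inl ?_
    simp only [split, List.set_eq_of_length_le (not_lt.1 hlen)]
    exact hx

/-- The coordinate intervals as Mathlib intervals (a coordinate with `lo > hi`, which no point
satisfies, is sent to the point interval `[lo, lo]`). [folklore] -/
def toIvl (B : Box) (i : ℕ) : NonemptyInterval ℚ :=
  if h : (B.ivl i).1 ≤ (B.ivl i).2 then ⟨B.ivl i, h⟩ else pure (B.ivl i).1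

/-- A point of the box lies coordinatewise in `toIvl`. [folklore] -/
theorem mem_toIvl {B : Box} {x : ℕ → ℝ} (hx : B.mem x) (i : ℕ) : x i ∈ (B.toIvl i).ratCast ℝ := by
  have h := hx i
  have hle : (B.ivl i).1 ≤ (B.ivl i).2 := by exact_mod_cast h.1.trans h.2
  rw [toIvl, dif_pos hle, mem_ratCast_iff]
  exact h

end Box

/-! ### kd-tree certificates -/

/-- A kd-tree certificate over a box: a leaf carrying the datum of a per-box check, or a split of
coordinate `axis` at the rational `cut` with certificates for the two halves. [folklore] -/
inductive KdCert (α : Type) : Type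
  /-- a leaf: run the leaf check with datum `a` on the current box -/
  | leaf (a : α) : KdCert α
  /-- bisect coordinate `axis` at `cut`; `lo` certifies `[.., cut]`, `hi` certifies `[cut, ..]` -/
  | split (axis : ℕ) (cut : ℚ) (lo hi : KdCert α) : KdCert α
  deriving Inhabited

namespace KdCert

variable {α : Type}

/-- **The tree checker**: walk the tree, computing the box of each node, and run `leafOK` on the
leaves (structural recursion; kernel-evaluable when `leafOK` is). [folklore] -/
def check (leafOK : Box → α → Bool) : Box → KdCert α → Bool
  | B, leaf a => leafOK B a
  | B, split axis c t₁ t₂ => check leafOK (B.split axis c).1 t₁ && check leafOK (B.split axis c).2 t₂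

/-- Number of leaves (the cost of the check). [folklore] -/
def size : KdCert α → ℕ
  | leaf _ => 1
  | split _ _ t₁ t₂ => size t₁ + size t₂

/-- **Soundness of kd-tree certificates.** If an accepted leaf check proves `P` at every point of
its box, then an accepted tree proves `P` at every point of the root box. [folklore] -/
theorem sound {P : (ℕ → ℝ) → Prop} {leafOK : Box → α → Bool}
    (hleaf : ∀ B a, leafOK B a = true → ∀ x, B.mem x → P x) :
    ∀ (t : KdCert α) (B : Box), check leafOK B t = true → ∀ x, B.mem x → P x
  | leaf a, B, h, x, hx => hleaf B a h x hx
  | split axis c t₁ t₂, B, h, x, hx => by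
    rw [check, Bool.and_eq_true] at h
    rcases Box.mem_split hx axis c with h1 | h2
    · exact sound hleaf t₁ _ h.1 x h1
    · exact sound hleaf t₂ _ h.2 x h2

/-- The 1-D WINDOW format: a first leaf datum and a list of (breakpoint, datum) pairs
`a₀, [(c₁, a₁), …, (c_k, a_k)]` stands for the cells `[lo, c₁], [c₁, c₂], …, [c_k, hi]` of
coordinate `0` with one leaf check each (breakpoints should increase; soundness holds regardless).
[folklore] -/
def ofCuts (a₀ : α) : List (ℚ × α) → KdCert α
  | [] => leaf a₀
  | (c, a) :: rest => split 0 c (leaf a₀) (ofCuts a rest)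

/-- A window certificate has one leaf per cell. [folklore] -/
theorem size_ofCuts (a₀ : α) (l : List (ℚ × α)) : (ofCuts a₀ l).size = l.length + 1 := by
  induction l generalizing a₀ with
  | nil => rfl
  | cons p rest ih =>
    obtain ⟨c, a⟩ := p
    simp only [ofCuts, size, ih, List.length_cons]
    omega

end KdCert

/-! ### The worked leaf check: an expression bound by interval evaluation -/

/-- Leaf check "`e ≤ b` on the box `B`": the right end of the natural interval extension of `e` on
`B` at working precision `prec` is `≤ b` (Moore 1966, Theorem 3.1). [cite: Moore1966, Theorem 3.1] -/
def exprLeOn (e : ArithExpr) (b : ℚ) (B : Box) (prec : ℕ) : Bool :=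
  decide ((e.enclose prec B.toIvl).snd ≤ b)

/-- **Soundness of the leaf check** (inclusion property). [cite: Moore1966, Theorem 3.1] -/
theorem exprLeOn_sound {e : ArithExpr} {b : ℚ} {B : Box} {prec : ℕ} (h : exprLeOn e b B prec = true)
    (x : ℕ → ℝ) (hx : B.mem x) : e.eval x ≤ b :=
  (e.eval_le_snd_enclose prec (Box.mem_toIvl hx)).trans (Rat.cast_le.2 (of_decide_eq_true h))

/-- **`e ≤ b` on a box from a kd-tree of precisions.** [cite: Moore1966, Theorem 3.1, §4.4] -/
theorem eval_le_of_kdCheck {e : ArithExpr} {b : ℚ} {B : Box} {t : KdCert ℕ}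
    (h : t.check (exprLeOn e b) B = true) (x : ℕ → ℝ) (hx : B.mem x) : e.eval x ≤ b :=
  KdCert.sound (fun _ _ hl x hx ↦ exprLeOn_sound hl x hx) t B h x hx

/-- A **box bound claim**: `expr ≤ bound` at every real point of the rational box `box`. [folklore] -/
structure BoxBoundClaim where
  /-- the expression to be bounded -/
  expr : ArithExpr
  /-- the box -/
  box : Box
  /-- the claimed upper bound -/
  bound : ℚ

/-- The proposition asserted by a box bound claim. [folklore] -/
def BoxBoundClaim.Holds (c : BoxBoundClaim) : Prop := ∀ x : ℕ → ℝ, c.box.mem x → c.expr.eval x ≤ c.bound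

/-- **The subdividing bound verifier**: certificates are kd-trees whose leaves carry working
precisions; the checker evaluates the natural interval extension on every leaf box
(cf. `boundVerifier`, the one-box case). [cite: Moore1966, Theorem 3.1, §4.4] -/
def kdBoundVerifier : Verifier BoxBoundClaim BoxBoundClaim.Holds where
  Cert := KdCert ℕ
  check c t := t.check (exprLeOn c.expr c.bound) c.box
  sound _ _ h x hx := eval_le_of_kdCheck h x hx

/-- The checker of `kdBoundVerifier`, unfolded. [folklore] -/
@[simp] theorem kdBoundVerifier_check (c : BoxBoundClaim) (t : KdCert ℕ) :
    kdBoundVerifier.check c t = t.check (exprLeOn c.expr c.bound) c.box := rfl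

/-- **Soundness of the subdividing bound verifier** in the statement shape of `Certificate.lean`.
[cite: Moore1966, Theorem 3.1, §4.4] -/
theorem BoxBoundClaim.holds_of_check (c : BoxBoundClaim) (t : KdCert ℕ)
    (h : kdBoundVerifier.check c t = true) : c.Holds :=
  kdBoundVerifier.claim t h

/-- Kernel example. On `[0, 1]` the natural interval extension of `x(1 − x)` is `[0, 1]`, so the
one-box check of `x(1 − x) ≤ 3/8` fails; bisecting twice (cells of width `1/4`, precision `4`)
proves it: `[0,¼]·[¾,1] ≤ ¼`, `[¼,½]·[½,¾] ≤ ⅜`, `[½,¾]·[¼,½] ≤ ⅜`, `[¾,1]·[0,¼] ≤ ¼`. -/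
example : BoxBoundClaim.Holds ⟨.mul (.var 0) (.sub (.const 1) (.var 0)), [(0, 1)], 3 / 8⟩ :=
  BoxBoundClaim.holds_of_check _
    (.split 0 (1/2) (.split 0 (1/4) (.leaf 4) (.leaf 4)) (.split 0 (3/4) (.leaf 4) (.leaf 4)))
    (by decide +kernel)

/-- The same certificate in the window format `ofCuts`. -/
example : BoxBoundClaim.Holds ⟨.mul (.var 0) (.sub (.const 1) (.var 0)), [(0, 1)], 3 / 8⟩ :=
  BoxBoundClaim.holds_of_check _ (KdCert.ofCuts 4 [(1/4, 4), (1/2, 4), (3/4, 4)]) (by decide +kernel)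

end Literature.Analysis.ValidatedNumerics
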